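import Literature.MathematicalPhysics.QuantumFieldTheory.Balaban1983to89.B6Prop22SixMultiLevelBox
import Literature.MathematicalPhysics.QuantumFieldTheory.Balaban1983to89.B6Prop22HolderMultiLevelBoxRateUnif
import Literature.MathematicalPhysics.QuantumFieldTheory.Balaban1983to89.B6Prop22DualHolderMultiLevelBoxRateUnif

/-!
# `Balaban1983to89.B6Prop22SixMultiLevelBoxRateUnif` — [B6] PROPOSITION 2.2, ALL SIX ENTRIES OF (2.67) FOR THE GENUINE
`k`-LEVEL OPERATOR `G′ = Δ′_a^{−1}` ON A BOX, IN THE PRINTED QUANTIFIER ORDER: ONE rate `δ₀`, ONE «M sufficiently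
large» `M₀`, ONE (2.59)-threshold `N₀` and ONE constant `C` for the four `α`-free entries, and for EVERY Hölder
exponent `0 ≤ α < 1` an `α`-dependent constant `C_α` for the two Hölder entries AT THE SAME `δ₀, M₀, N₀` (the `_unif`
twin of p21's `B6Prop22SixMultiLevelBox`; no existing module is touched; no fact is minted)

FRAMING (verbatim cell line):
statement-level skeleton of published theorems with citation tags; proofs where landed; nothing here is a claim about the Yang–Mills mass gap

Source under audit (cell pub-balaban / lit-balaban): T. Bałaban, *Propagators and renormalization transformations for
lattice gauge theories. II*, Commun. Math. Phys. **96** (1984) 223–250 [`Balaban1984PropagatorsII`, "B6"], p. 234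
[PDF 12] Proposition 2.2 (2.67) (render
`run/shared/lean/pub/pub-balaban/b2b-balaban-ref1/pages/1984-cmp96-propagators-rt-II/…-p012-x2.png`); [3] =
T. Bałaban, *Regularity and decay of lattice Green's functions*, Commun. Math. Phys. **89** (1983) 571–597
[`Balaban1983RegularityDecay`], Theorem (1.9) p. 573 («δ₀, c₀, R₀ … depending on d, M only, c₀ on α also»).
PDF held: `paper:balaban1984-cmp96-propagators-rt-ii` (journal page = PDF page + 222).  Unit `lit-balaban-p21`
(Phase-2 proof seat p21 gen 12), HOME `run/shared/lean/pub/lit-balaban/`, B6 fold owner r03 (row **B6.Prop2.2**),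
referee ref-4.

## WHAT IS PRINTED (p. 234, verbatim up to notation)

«**Proposition 2.2.** If we have (2.1), (2.2) and M is sufficiently large, then the operator G′ = Δ′_a^{−1} (a = 1)
satisfies the inequalities |(G′λ)(x)|, |(∇^η_xG′λ)(x)|, |(G′∇^{η*}λ)(x)|, ‖ζ∇^η_xG′λ‖_α, ‖ζG′∇^{η*}λ‖_α, |(Δ^ηG′λ)(x)|
≤ O(1)[(L^jη)², L^jη, L^jη, (L^jη)^{1−α}(‖ζ‖_α + |ζ|), (L^jη)^{1−α}(‖ζ‖_α + |ζ|), 1]·e^{−½δ₀d(y,y′)}|λ|, x ∈ B^j(y) or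
supp ζ ⊂ B^j(y), y ∈ Λ_j, supp λ ⊂ B^{j′}(y′), y′ ∈ Λ_{j′}. (2.67)» — ONE «δ₀», ONE «M sufficiently large»; the
`α`-dependence is in «O(1)» only (census typing `B6.Prop22Printed`: `∃ M₁ δ₀ C, ∃ Cα : ℝ → ℝ, … ∀ α`).

## WHAT THIS FILE CERTIFIES (kernel-checked)

`prop22_six_multiLevelBox_unif`: there are `δ₀, C, M₀ > 0`, `N₀ ≥ 1` (functions of `d`, `ℓ`, the windows) such that
(i) for every `k`, `M_h ≥ 3` with `L·M_h ≥ M₀`, `R ≥ 2L` with `RM ≥ N₀ + 1`, volume, nested family `D` (2.1)–(2.2) and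
weights in the windows with `a_{i+1} = aNext ℓ a_i c_i`, the genuine `k`-level `G′ = gml` has the FIRST (`C·L^{2j}`),
SECOND and THIRD (`C·L^{j}`, every axis) and SIXTH (`C`) entries as majorants on the blocks at the rate `½δ₀`
(`B6Prop22AllMultiLevelBox.prop22_entries1236_multiLevelBox`, `α`-free), and (ii) for every `0 ≤ α < 1` there is
`C_α > 0` such that, for the SAME data and thresholds, the FOURTH and FIFTH entries (`C_α·(L^{j})^{1−α}`, every axis)
hold as majorants of the lifted pair functionals on `pairs ⊕ sites` at the SAME rate `½δ₀`
(`B6Prop22HolderMultiLevelBoxRateUnif.hasMajorant_holder_multiLevelBox_unif`,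
`B6Prop22DualHolderMultiLevelBoxRateUnif.hasMajorant_dualHolder_multiLevelBox_unif`); `prop22_six_pointwise_multiLevelBox_unif`
reads the two Hölder entries back on the pairs (same constants).  Rates by `min`, thresholds by `max`.

## HONEST SCOPE

The quantifier shape is print's «∃ (δ₀, M₀, N₀, C) [entries 1, 2, 3, 6] ∧ ∀ α ∈ [0,1) ∃ C_α [entries 4, 5]».
Otherwise as files 1–14 of the lineage: levels `1 … k`, Neumann box, `m² = 0`, `M_h ≥ 3`, lattice units (`L^{2j}`,
`L^{j}`, `(L^{j})^{1−α}` for «(L^jη)²», «L^jη», «(L^jη)^{1−α}»; the Hölder pairs are the pairs of ONE block, `ζ`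
dispensed with as in [3] (1.9)), `L`-dependent (2.61)-constant, constants existential.  No new estimate — the
conjunction of landed theorems.  NOT summit progress.
-/

namespace Literature.MathematicalPhysics.QuantumFieldTheory.Balaban1983to89.B6Prop22SixMultiLevelBoxRateUnif

open Matrix
open Literature.MathematicalPhysics.QuantumFieldTheory.Balaban1983to89.B4Reflection242 (boxDom)
open Literature.MathematicalPhysics.QuantumFieldTheory.Balaban1983to89.B4ContourShift (supNorm supNorm_nonneg)
open Literature.MathematicalPhysics.QuantumFieldTheory.Balaban1983to89.B4BoxCov237 (opBoxR)
open Literature.MathematicalPhysics.QuantumFieldTheory.Balaban1983to89.B6Ineq243TwoLevelBox (aNext)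
open Literature.MathematicalPhysics.QuantumFieldTheory.Balaban1983to89.B6MultiLevelBoxOperator
open Literature.MathematicalPhysics.QuantumFieldTheory.Balaban1983to89.B6Geom246MultiLevelBox
open Literature.MathematicalPhysics.QuantumFieldTheory.Balaban1983to89.B6Prop22MultiLevelBox
open Literature.MathematicalPhysics.QuantumFieldTheory.Balaban1983to89.B6Prop22DerivMultiLevelBox (dMat)
open Literature.MathematicalPhysics.QuantumFieldTheory.Balaban1983to89.B6Prop22AllMultiLevelBox
  (prop22_entries1236_multiLevelBox)
open Literature.MathematicalPhysics.QuantumFieldTheory.Balaban1983to89.B6Prop22HolderMultiLevelBox (liftL HPair blkP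
  holderOp holderOp_apply rowBound_of_hasMajorant_liftL)
open Literature.MathematicalPhysics.QuantumFieldTheory.Balaban1983to89.B6Prop22DualHolderMultiLevelBox (BPair blkB dualOp
  dualOp_apply)
open Literature.MathematicalPhysics.QuantumFieldTheory.Balaban1983to89.B6Prop22HolderMultiLevelBoxRateUnif
  (hasMajorant_holder_multiLevelBox_unif)
open Literature.MathematicalPhysics.QuantumFieldTheory.Balaban1983to89.B6Prop22DualHolderMultiLevelBoxRateUnif
  (hasMajorant_dualHolder_multiLevelBox_unif)
open Literature.MathematicalPhysics.QuantumFieldTheory.Balaban1983to89.B6RandomWalk (HasMajorant BlockSupp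
  hasMajorant_mono)

noncomputable section

variable {d : ℕ}

/-- **[B6] PROPOSITION 2.2, ALL SIX ENTRIES OF (2.67), GENUINE `k`-LEVEL OPERATOR, PRINTED QUANTIFIER ORDER**: one
`δ₀`, one `M₀`, one `N₀` and one `C` for the four `α`-free entries (1, 2, 3, 6), and for every `0 ≤ α < 1` a `C_α` for the
two Hölder entries (4, 5) at the same `δ₀, M₀, N₀`. [cite: Balaban1984PropagatorsII, Proposition 2.2 (2.67) p.234] -/
theorem prop22_six_multiLevelBox_unif (d ℓ : ℕ) (hℓ : 1 ≤ ℓ) (aminus aplus a2minus a2plus : ℝ) (ha : 0 < aminus)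
    (ha2 : 0 < a2minus) :
    ∃ δ₀ C M₀ : ℝ, ∃ N₀ : ℕ, 0 < δ₀ ∧ 0 < C ∧ 0 < M₀ ∧ 0 < N₀ ∧
      (∀ (k Mh R : ℕ), 3 ≤ Mh → M₀ ≤ ((ℓ : ℝ) + 1) * Mh → 2 * (ℓ + 1) ≤ R → N₀ + 1 ≤ R * ((ℓ + 1) * Mh) →
        ∀ (P : Fin (d + 1) → ℕ) (hP : ∀ μ, 1 ≤ P μ) (D : Domains d ℓ Mh k P R) (a c : ℕ → ℝ),
          (∀ i, 1 ≤ i → aminus ≤ a i ∧ a i ≤ aplus) → (∀ i, 1 ≤ i → a2minus ≤ c i ∧ c i ≤ a2plus) →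
          (∀ i, 1 ≤ i → a (i + 1) = aNext ℓ (a i) (c i)) →
          HasMajorant (g := geom D) (blkOf D) (Matrix.toLin' (gml (N0 ℓ Mh k P) ℓ k D.lev a))
              (fun y y' => C * ((ℓ : ℝ) + 1) ^ (2 * y.1.1) * Real.exp (-(δ₀ / 2 * (geom D).dist y y')))
            ∧ (∀ μ : Fin (d + 1), HasMajorant (g := geom D) (blkOf D)
                (Matrix.toLin' (dMat (N0 ℓ Mh k P) μ * gml (N0 ℓ Mh k P) ℓ k D.lev a))
                (fun y y' => C * ((ℓ : ℝ) + 1) ^ y.1.1 * Real.exp (-(δ₀ / 2 * (geom D).dist y y'))))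
            ∧ (∀ μ : Fin (d + 1), HasMajorant (g := geom D) (blkOf D)
                (Matrix.toLin' (gml (N0 ℓ Mh k P) ℓ k D.lev a * (dMat (N0 ℓ Mh k P) μ)ᵀ))
                (fun y y' => C * ((ℓ : ℝ) + 1) ^ y.1.1 * Real.exp (-(δ₀ / 2 * (geom D).dist y y'))))
            ∧ HasMajorant (g := geom D) (blkOf D)
                (Matrix.toLin' (opBoxR 1 0 0 1 (N0 ℓ Mh k P) * gml (N0 ℓ Mh k P) ℓ k D.lev a))
                (fun y y' => C * Real.exp (-(δ₀ / 2 * (geom D).dist y y'))))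
      ∧ (∀ (α : ℝ), 0 ≤ α → α < 1 → ∃ Cα : ℝ, 0 < Cα ∧
        ∀ (k Mh R : ℕ), 3 ≤ Mh → M₀ ≤ ((ℓ : ℝ) + 1) * Mh → 2 * (ℓ + 1) ≤ R → N₀ + 1 ≤ R * ((ℓ + 1) * Mh) →
        ∀ (P : Fin (d + 1) → ℕ) (hP : ∀ μ, 1 ≤ P μ) (D : Domains d ℓ Mh k P R) (a c : ℕ → ℝ),
          (∀ i, 1 ≤ i → aminus ≤ a i ∧ a i ≤ aplus) → (∀ i, 1 ≤ i → a2minus ≤ c i ∧ c i ≤ a2plus) →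
          (∀ i, 1 ≤ i → a (i + 1) = aNext ℓ (a i) (c i)) →
          (∀ μ : Fin (d + 1), HasMajorant (g := geom D) (Sum.elim (blkP D μ) (blkOf D))
              (liftL (holderOp D μ α (gml (N0 ℓ Mh k P) ℓ k D.lev a)))
              (fun y y' => Cα * (((ℓ : ℝ) + 1) ^ y.1.1) ^ (1 - α) * Real.exp (-(δ₀ / 2 * (geom D).dist y y'))))
          ∧ (∀ μ : Fin (d + 1), HasMajorant (g := geom D) (Sum.elim (blkB D) (blkOf D))
              (liftL (dualOp D α (gml (N0 ℓ Mh k P) ℓ k D.lev a * (dMat (N0 ℓ Mh k P) μ)ᵀ)))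
              (fun y y' => Cα * (((ℓ : ℝ) + 1) ^ y.1.1) ^ (1 - α) * Real.exp (-(δ₀ / 2 * (geom D).dist y y'))))) := by
  obtain ⟨δ₁, C₁, M₁, N₁, hδ₁, hC₁, hM₁, hN₁, h1⟩ :=
    prop22_entries1236_multiLevelBox d ℓ hℓ aminus aplus a2minus a2plus ha ha2
  obtain ⟨δ₄, M₄, N₄, hδ₄, hM₄, hN₄, h4A⟩ :=
    hasMajorant_holder_multiLevelBox_unif d ℓ hℓ aminus aplus a2minus a2plus ha ha2
  obtain ⟨δ₅, M₅, N₅, hδ₅, hM₅, hN₅, h5A⟩ :=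
    hasMajorant_dualHolder_multiLevelBox_unif d ℓ hℓ aminus aplus a2minus a2plus ha ha2
  -- the weakening of a majorant prefactor `Cc·p·e^{−δd/2}` to the smallest rate and a larger constant
  have hweak : ∀ {k Mh R : ℕ} {P : Fin (d + 1) → ℕ} (D : Domains d ℓ Mh k P R), 1 ≤ Mh → (∀ μ, 1 ≤ P μ) →
      ∀ (δ Cc Cmax : ℝ), min δ₁ (min δ₄ δ₅) ≤ δ → 0 ≤ Cc → Cc ≤ Cmax →
      ∀ (p : ℝ), 0 ≤ p → ∀ y y' : (geom D).Site,
        Cc * p * Real.exp (-(δ / 2 * (geom D).dist y y'))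
          ≤ Cmax * p * Real.exp (-(min δ₁ (min δ₄ δ₅) / 2 * (geom D).dist y y')) := by
    intro k Mh R P D hMh1 hP δ Cc Cmax hδ hC0 hCle p hp y y'
    have hdnn : 0 ≤ (geom D).dist y y' := (triangle_refl_nonneg D hMh1 hP).2.2 y y'
    have he : Real.exp (-(δ / 2 * (geom D).dist y y'))
        ≤ Real.exp (-(min δ₁ (min δ₄ δ₅) / 2 * (geom D).dist y y')) := by
      rw [Real.exp_le_exp, neg_le_neg_iff]
      exact mul_le_mul_of_nonneg_right (by linarith) hdnn
    exact mul_le_mul (mul_le_mul_of_nonneg_right hCle hp) he (Real.exp_pos _).le (mul_nonneg (hC0.trans hCle) hp)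
  have hδ1le : min δ₁ (min δ₄ δ₅) ≤ δ₁ := min_le_left _ _
  have hδ4le : min δ₁ (min δ₄ δ₅) ≤ δ₄ := (min_le_right _ _).trans (min_le_left _ _)
  have hδ5le : min δ₁ (min δ₄ δ₅) ≤ δ₅ := (min_le_right _ _).trans (min_le_right _ _)
  refine ⟨min δ₁ (min δ₄ δ₅), C₁, max M₁ (max M₄ M₅), max N₁ (max N₄ N₅),
    lt_min hδ₁ (lt_min hδ₄ hδ₅), hC₁, lt_max_of_lt_left hM₁, lt_max_of_lt_left hN₁, ?_, fun α hα0 hα1 => ?_⟩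
  · intro k Mh R hMh hM hR hRM P hP D a c haw hcw hac
    have hMh1 : 1 ≤ Mh := le_trans (by norm_num) hMh
    have hM1' : M₁ ≤ ((ℓ : ℝ) + 1) * Mh := (le_max_left _ _).trans hM
    have hN1' : N₁ + 1 ≤ R * ((ℓ + 1) * Mh) := le_trans (by omega) hRM
    obtain ⟨h11, h12, h13, h16⟩ := h1 k Mh R hMh hM1' hR hN1' P hP D a c haw hcw hac
    refine ⟨?_, fun μ => ?_, fun μ => ?_, ?_⟩
    · refine hasMajorant_mono (g := geom D) (blkOf D) h11 fun y y' => ?_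
      exact hweak D hMh1 hP δ₁ C₁ C₁ hδ1le hC₁.le le_rfl _ (by positivity) y y'
    · refine hasMajorant_mono (g := geom D) (blkOf D) (h12 μ) fun y y' => ?_
      exact hweak D hMh1 hP δ₁ C₁ C₁ hδ1le hC₁.le le_rfl _ (by positivity) y y'
    · refine hasMajorant_mono (g := geom D) (blkOf D) (h13 μ) fun y y' => ?_
      exact hweak D hMh1 hP δ₁ C₁ C₁ hδ1le hC₁.le le_rfl _ (by positivity) y y'
    · refine hasMajorant_mono (g := geom D) (blkOf D) h16 fun y y' => ?_
      have h := hweak D hMh1 hP δ₁ C₁ C₁ hδ1le hC₁.le le_rfl 1 zero_le_one y y'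
      simp only [mul_one] at h
      exact h
  · obtain ⟨C₄, hC₄, h4⟩ := h4A α hα0 hα1
    obtain ⟨C₅, hC₅, h5⟩ := h5A α hα0 hα1
    refine ⟨max C₄ C₅, lt_max_of_lt_left hC₄, ?_⟩
    intro k Mh R hMh hM hR hRM P hP D a c haw hcw hac
    have hMh1 : 1 ≤ Mh := le_trans (by norm_num) hMh
    have hM4' : M₄ ≤ ((ℓ : ℝ) + 1) * Mh := ((le_max_left _ _).trans (le_max_right _ _)).trans hM
    have hM5' : M₅ ≤ ((ℓ : ℝ) + 1) * Mh := ((le_max_right _ _).trans (le_max_right _ _)).trans hM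
    have hN4' : N₄ + 1 ≤ R * ((ℓ + 1) * Mh) :=
      le_trans (by have := le_max_left N₄ N₅; have := le_max_right N₁ (max N₄ N₅); omega) hRM
    have hN5' : N₅ + 1 ≤ R * ((ℓ + 1) * Mh) :=
      le_trans (by have := le_max_right N₄ N₅; have := le_max_right N₁ (max N₄ N₅); omega) hRM
    refine ⟨fun μ => ?_, fun μ => ?_⟩
    · refine hasMajorant_mono (g := geom D) (Sum.elim (blkP D μ) (blkOf D))
        (h4 k Mh R hMh hM4' hR hN4' P hP D a c haw hcw hac μ) fun y y' => ?_
      exact hweak D hMh1 hP δ₄ C₄ (max C₄ C₅) hδ4le hC₄.le (le_max_left _ _) _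
        (Real.rpow_nonneg (by positivity) _) y y'
    · refine hasMajorant_mono (g := geom D) (Sum.elim (blkB D) (blkOf D))
        (h5 k Mh R hMh hM5' hR hN5' P hP D a c haw hcw hac μ) fun y y' => ?_
      exact hweak D hMh1 hP δ₅ C₅ (max C₄ C₅) hδ5le hC₅.le (le_max_right _ _) _
        (Real.rpow_nonneg (by positivity) _) y y'

/-- **THE SAME, WITH THE TWO HÖLDER ENTRIES READ BACK ON THE PAIRS** (printed quantifier order; the four `α`-free entries
as majorants with one `C`, and for every `0 ≤ α < 1` a `C_α` with, for all `x ≠ x̂` of one block `B^j(y)` and `λ` supported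
in `B^{j′}(y′)`, every axis `μ`:
`|x̂−x|^{−α}|((∇_μG′λ)(x̂) − (∇_μG′λ)(x))| ≤ C_α(L^j)^{1−α}e^{−½δ₀d(y,y′)}sup|λ|` (when `x+e_μ`, `x̂+e_μ` lie in the box) and
`|x̂−x|^{−α}|((G′∂_μᵀλ)(x̂) − (G′∂_μᵀλ)(x))| ≤ C_α(L^j)^{1−α}e^{−½δ₀d(y,y′)}sup|λ|`) — the input of the census Hölder conjunct
on the `k`-level family in print's order.
[cite: Balaban1984PropagatorsII, Proposition 2.2 (2.67) p.234 (fourth and fifth entries); Balaban1983RegularityDecay, Theorem (1.9) p.573] -/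
theorem prop22_six_pointwise_multiLevelBox_unif (d ℓ : ℕ) (hℓ : 1 ≤ ℓ) (aminus aplus a2minus a2plus : ℝ)
    (ha : 0 < aminus) (ha2 : 0 < a2minus) :
    ∃ δ₀ C M₀ : ℝ, ∃ N₀ : ℕ, 0 < δ₀ ∧ 0 < C ∧ 0 < M₀ ∧ 0 < N₀ ∧
      (∀ (k Mh R : ℕ), 3 ≤ Mh → M₀ ≤ ((ℓ : ℝ) + 1) * Mh → 2 * (ℓ + 1) ≤ R → N₀ + 1 ≤ R * ((ℓ + 1) * Mh) →
        ∀ (P : Fin (d + 1) → ℕ) (hP : ∀ μ, 1 ≤ P μ) (D : Domains d ℓ Mh k P R) (a c : ℕ → ℝ),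
          (∀ i, 1 ≤ i → aminus ≤ a i ∧ a i ≤ aplus) → (∀ i, 1 ≤ i → a2minus ≤ c i ∧ c i ≤ a2plus) →
          (∀ i, 1 ≤ i → a (i + 1) = aNext ℓ (a i) (c i)) →
          HasMajorant (g := geom D) (blkOf D) (Matrix.toLin' (gml (N0 ℓ Mh k P) ℓ k D.lev a))
              (fun y y' => C * ((ℓ : ℝ) + 1) ^ (2 * y.1.1) * Real.exp (-(δ₀ / 2 * (geom D).dist y y')))
            ∧ (∀ μ : Fin (d + 1), HasMajorant (g := geom D) (blkOf D)
                (Matrix.toLin' (dMat (N0 ℓ Mh k P) μ * gml (N0 ℓ Mh k P) ℓ k D.lev a))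
                (fun y y' => C * ((ℓ : ℝ) + 1) ^ y.1.1 * Real.exp (-(δ₀ / 2 * (geom D).dist y y'))))
            ∧ (∀ μ : Fin (d + 1), HasMajorant (g := geom D) (blkOf D)
                (Matrix.toLin' (gml (N0 ℓ Mh k P) ℓ k D.lev a * (dMat (N0 ℓ Mh k P) μ)ᵀ))
                (fun y y' => C * ((ℓ : ℝ) + 1) ^ y.1.1 * Real.exp (-(δ₀ / 2 * (geom D).dist y y'))))
            ∧ HasMajorant (g := geom D) (blkOf D)
                (Matrix.toLin' (opBoxR 1 0 0 1 (N0 ℓ Mh k P) * gml (N0 ℓ Mh k P) ℓ k D.lev a))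
                (fun y y' => C * Real.exp (-(δ₀ / 2 * (geom D).dist y y'))))
      ∧ (∀ (α : ℝ), 0 ≤ α → α < 1 → ∃ Cα : ℝ, 0 < Cα ∧
        ∀ (k Mh R : ℕ), 3 ≤ Mh → M₀ ≤ ((ℓ : ℝ) + 1) * Mh → 2 * (ℓ + 1) ≤ R → N₀ + 1 ≤ R * ((ℓ + 1) * Mh) →
        ∀ (P : Fin (d + 1) → ℕ) (hP : ∀ μ, 1 ≤ P μ) (D : Domains d ℓ Mh k P R) (a c : ℕ → ℝ),
          (∀ i, 1 ≤ i → aminus ≤ a i ∧ a i ≤ aplus) → (∀ i, 1 ≤ i → a2minus ≤ c i ∧ c i ≤ a2plus) →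
          (∀ i, 1 ≤ i → a (i + 1) = aNext ℓ (a i) (c i)) →
          ∀ (μ : Fin (d + 1)) (y' : ↥(bset D)) (lam : ↥(boxDom (N0 ℓ Mh k P)) → ℝ) (B : ℝ),
            BlockSupp (g := geom D) (blkOf D) lam y' B →
            ∀ (x x' : ↥(boxDom (N0 ℓ Mh k P))), x'.1 ≠ x.1 → blkOf D x' = blkOf D x →
              (∀ (hxe : x.1 + Pi.single μ 1 ∈ boxDom (N0 ℓ Mh k P))
                  (hxe' : x'.1 + Pi.single μ 1 ∈ boxDom (N0 ℓ Mh k P)),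
                (supNorm (x'.1 - x.1)) ^ (-α)
                    * |((gml (N0 ℓ Mh k P) ℓ k D.lev a *ᵥ lam) ⟨x'.1 + Pi.single μ 1, hxe'⟩
                          - (gml (N0 ℓ Mh k P) ℓ k D.lev a *ᵥ lam) x')
                        - ((gml (N0 ℓ Mh k P) ℓ k D.lev a *ᵥ lam) ⟨x.1 + Pi.single μ 1, hxe⟩
                          - (gml (N0 ℓ Mh k P) ℓ k D.lev a *ᵥ lam) x)|
                  ≤ Cα * (((ℓ : ℝ) + 1) ^ D.lev x.1) ^ (1 - α)
                    * Real.exp (-(δ₀ / 2 * (geom D).dist (blkOf D x) y')) * B)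
              ∧ (supNorm (x'.1 - x.1)) ^ (-α)
                  * |((gml (N0 ℓ Mh k P) ℓ k D.lev a * (dMat (N0 ℓ Mh k P) μ)ᵀ) *ᵥ lam) x'
                      - ((gml (N0 ℓ Mh k P) ℓ k D.lev a * (dMat (N0 ℓ Mh k P) μ)ᵀ) *ᵥ lam) x|
                ≤ Cα * (((ℓ : ℝ) + 1) ^ D.lev x.1) ^ (1 - α)
                  * Real.exp (-(δ₀ / 2 * (geom D).dist (blkOf D x) y')) * B) := by
  obtain ⟨δ₀, C, M₀, N₀, hδ₀, hC, hM₀, hN₀, hS, hH⟩ :=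
    prop22_six_multiLevelBox_unif d ℓ hℓ aminus aplus a2minus a2plus ha ha2
  refine ⟨δ₀, C, M₀, N₀, hδ₀, hC, hM₀, hN₀, hS, fun α hα0 hα1 => ?_⟩
  obtain ⟨Cα, hCα, h⟩ := hH α hα0 hα1
  refine ⟨Cα, hCα, ?_⟩
  intro k Mh R hMh hM hR hRM P hP D a c haw hcw hac μ y' lam B hlam x x' hne hblk
  obtain ⟨h4, h5⟩ := h k Mh R hMh hM hR hRM P hP D a c haw hcw hac
  refine ⟨fun hxe hxe' => ?_, ?_⟩
  · have hrow := rowBound_of_hasMajorant_liftL (g := geom D) (blkOf D) (blkP D μ) (h4 μ) y' lam B hlam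
      (⟨x, x', hne, hblk, hxe, hxe'⟩ : HPair D μ)
    rw [holderOp_apply, abs_mul, abs_of_nonneg (Real.rpow_nonneg (supNorm_nonneg _) _)] at hrow
    exact hrow
  · have hrow := rowBound_of_hasMajorant_liftL (g := geom D) (blkOf D) (blkB D) (h5 μ) y' lam B hlam
      (⟨x, x', hne, hblk⟩ : BPair D)
    rw [dualOp_apply, abs_mul, abs_of_nonneg (Real.rpow_nonneg (supNorm_nonneg _) _)] at hrow
    exact hrow

end

end Literature.MathematicalPhysics.QuantumFieldTheory.Balaban1983to89.B6Prop22SixMultiLevelBoxRateUnif
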